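import Literature.AlgebraicGeometry.Resolution.ArithmeticalThreefoldsDescentHeadChoice
import Literature.AlgebraicGeometry.Resolution.ArithmeticalThreefoldsDescentHead
import HarnessLib

/-!
# Cossart–Piltant 2019, Prop. 4.8: the `∀`-form head implies the `∃`-form head (the re-cut is conservative)

Topic: `Literature/AlgebraicGeometry/Resolution` (proofs only; no new notions, no new named
facts). The geometric head of Cossart–Piltant's descent was typed in `∀`-form (for EVERY formal
branch `K̂₁`, embedding `ι` and extension `O'`; the binder `head` of
`CossartPiltant2019LU3OfComplete.of_head`, named `CossartPiltant2019_descentHead`) and re-cut in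
`∃`-form at rank one (`ArithmeticalThreefoldsDescentHeadChoice.lean`: the prover chooses the
branch and the extension, as in print). This file records that the re-cut is a WEAKENING of the
hypothesis, pointwise: since the data `(P̂₁, K̂₁ = QF(Â/P̂₁), ι, O')` always exist
(`exists_minimalPrime_valuationSubring_adicCompletion`, `ValuationExtensionToCompletion.lean`),
the `∀`-form head at a valuation ring `O` yields the `∃`-form head at `O`.

* `headChoiceAt_of_headAt` — for `A` a Noetherian local domain and `O` containing and dominating
  `A` with algebraic residue extension: the `∀`-form head at `O` implies the `∃`-form head at `O`
  (the construction of `cpLocalUniformization_of_head`, stopped before the descent tail);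
* `descentHeadChoiceRankOne_of_descentHead` — hence the named fact `CossartPiltant2019_descentHead`
  implies the rank-one `∃`-form head binder of `CossartPiltant2019LU3OfComplete.of_headChoiceRankOne`.

## Sources

* V. Cossart, O. Piltant, J. Algebra 529 (2019) 268–535 = arXiv:1412.0868, proof of Prop. 4.8
  (arXiv v1: Prop. 4.6, pp. 52–53: "Let `v̂` be an extension of `v` to, say `K̂₁`").
  [CossartPiltant2019]
-/

noncomputable section

namespace Literature.AlgebraicGeometry.Resolution

universe u

open IsLocalRing

section HeadForms

variable {A : Type u} [CommRing A] [IsDomain A] [IsLocalRing A] [IsNoetherianRing A]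
  {K : Type u} [Field K] [Algebra A K] [IsFractionRing A K]

/-- **The `∀`-form head at `O` implies the `∃`-form head at `O`.** For a Noetherian local
domain `A` with fraction field `K` and a valuation ring `O` of `K` containing and dominating `A`
with residue field algebraic over that of `A`: extend `v` to a formal branch
(`exists_minimalPrime_valuationSubring_adicCompletion`: a minimal prime `P̂₁` with
`P̂₁ ∩ A = 0`, `K̂₁ := QF(Â/P̂₁)`, `ι` the extension of `A → Â → K̂₁`, `O'` containing and
dominating `Â` with algebraic residues and `O' ∩ K = O`), feed the `∀`-form head, and keep its
output. [cite: CossartPiltant2019, proof of Prop. 4.8 (arXiv v1: Prop. 4.6, pp. 52–53)] -/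
theorem headChoiceAt_of_headAt (O : ValuationSubring K)
    (hAO : ∀ x : A, algebraMap A K x ∈ O)
    (hdom : ∀ x ∈ maximalIdeal A, O.valuation (algebraMap A K x) < 1)
    (halg : ∀ y : O, ∃ p : Polynomial A, (∃ i, p.coeff i ∉ maximalIdeal A) ∧
      O.valuation (p.eval₂ (algebraMap A K) y) < 1)
    (headAt : ∀ (K₁ : Type u) [Field K₁] [Algebra (AdicCompletion (maximalIdeal A) A) K₁],
      RingHom.ker (algebraMap (AdicCompletion (maximalIdeal A) A) K₁) ∈
        minimalPrimes (AdicCompletion (maximalIdeal A) A) →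
      (∀ z : K₁, ∃ a b : AdicCompletion (maximalIdeal A) A,
        z = algebraMap _ K₁ a / algebraMap _ K₁ b) →
      ∀ (ι : K →+* K₁), ι.comp (algebraMap A K) =
        (algebraMap (AdicCompletion (maximalIdeal A) A) K₁).comp
          (algebraMap A (AdicCompletion (maximalIdeal A) A)) →
      ∀ (O' : ValuationSubring K₁),
      (∀ x : AdicCompletion (maximalIdeal A) A, algebraMap _ K₁ x ∈ O') →
      (∀ x ∈ (maximalIdeal A).map (algebraMap A (AdicCompletion (maximalIdeal A) A)),
        O'.valuation (algebraMap _ K₁ x) < 1) →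
      (∀ y : O', ∃ p : Polynomial (AdicCompletion (maximalIdeal A) A),
        (∃ i, p.coeff i ∉
          (maximalIdeal A).map (algebraMap A (AdicCompletion (maximalIdeal A) A))) ∧
        O'.valuation (p.eval₂ (algebraMap (AdicCompletion (maximalIdeal A) A) K₁) y) < 1) →
      O'.comap ι = O →
      ∃ (S : Type u) (_ : CommRing S) (_ : IsRegularLocalRing S)
        (_ : Algebra (AdicCompletion (maximalIdeal A) A) S) (_ : Algebra S K₁),
        IsLocalHom (algebraMap (AdicCompletion (maximalIdeal A) A) S) ∧
        Algebra.EssFiniteType (AdicCompletion (maximalIdeal A) A) S ∧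
        IsScalarTower (AdicCompletion (maximalIdeal A) A) S K₁ ∧
        Function.Injective (algebraMap S K₁) ∧
        (∀ s : S, algebraMap S K₁ s ∈ O') ∧
        (∀ s ∈ maximalIdeal S, O'.valuation (algebraMap S K₁ s) < 1) ∧
        ∃ (d : ℕ) (z : Fin d → S) (a : Fin d → ℕ) (c : Fin d → Sˣ) (g : Fin d → K),
          Ideal.span (Set.range z) = maximalIdeal S ∧ (∀ j, 0 < a j) ∧
          ∀ j, ι (g j) = algebraMap S K₁ (c j * z j ^ a j)) :
    ∃ (K₁ : Type u) (_ : Field K₁) (_ : Algebra (AdicCompletion (maximalIdeal A) A) K₁),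
      RingHom.ker (algebraMap (AdicCompletion (maximalIdeal A) A) K₁) ∈
        minimalPrimes (AdicCompletion (maximalIdeal A) A) ∧
      (∀ z : K₁, ∃ a b : AdicCompletion (maximalIdeal A) A,
        z = algebraMap _ K₁ a / algebraMap _ K₁ b) ∧
      ∃ (ι : K →+* K₁), ι.comp (algebraMap A K) =
        (algebraMap (AdicCompletion (maximalIdeal A) A) K₁).comp
          (algebraMap A (AdicCompletion (maximalIdeal A) A)) ∧
      ∃ (O' : ValuationSubring K₁),
        (∀ y : O', ∃ q : Polynomial (AdicCompletion (maximalIdeal A) A),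
          (∃ i, q.coeff i ∉
            (maximalIdeal A).map (algebraMap A (AdicCompletion (maximalIdeal A) A))) ∧
          O'.valuation (q.eval₂ (algebraMap (AdicCompletion (maximalIdeal A) A) K₁) y) < 1) ∧
        O'.comap ι = O ∧
        ∃ (S : Type u) (_ : CommRing S) (_ : IsRegularLocalRing S)
          (_ : Algebra (AdicCompletion (maximalIdeal A) A) S) (_ : Algebra S K₁),
          IsLocalHom (algebraMap (AdicCompletion (maximalIdeal A) A) S) ∧
          Algebra.EssFiniteType (AdicCompletion (maximalIdeal A) A) S ∧
          IsScalarTower (AdicCompletion (maximalIdeal A) A) S K₁ ∧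
          Function.Injective (algebraMap S K₁) ∧
          (∀ s : S, algebraMap S K₁ s ∈ O') ∧
          (∀ s ∈ maximalIdeal S, O'.valuation (algebraMap S K₁ s) < 1) ∧
          ∃ (d : ℕ) (z : Fin d → S) (a : Fin d → ℕ) (c : Fin d → Sˣ) (g : Fin d → K),
            Ideal.span (Set.range z) = maximalIdeal S ∧ (∀ j, 0 < a j) ∧
            ∀ j, ι (g j) = algebraMap S K₁ (c j * z j ^ a j) := by
  set Ah := AdicCompletion (maximalIdeal A) A with hAhdef
  -- Step A: a minimal prime `P` of `Â` with `P ∩ A = 0` carrying an extension of `v`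
  obtain ⟨P, hPmin, hPA, H⟩ :=
    exists_minimalPrime_valuationSubring_adicCompletion.{u, u, u} O hAO hdom halg
  haveI hPprime : P.IsPrime := hPmin.1.1
  -- `R := Â/P`, `K̂₁ := QF(R)`
  haveI : IsLocalRing (Ah ⧸ P) :=
    IsLocalRing.of_surjective' (Ideal.Quotient.mk P) Ideal.Quotient.mk_surjective
  haveI : IsLocalHom (Ideal.Quotient.mk P) :=
    IsLocalHom.of_surjective _ Ideal.Quotient.mk_surjective
  set K₁ := FractionRing (Ah ⧸ P) with hK₁def
  have hRK₁ : Function.Injective (algebraMap (Ah ⧸ P) K₁) := IsFractionRing.injective _ _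
  have halgmap : ∀ x : Ah, algebraMap Ah K₁ x = algebraMap (Ah ⧸ P) K₁ (Ideal.Quotient.mk P x) :=
    fun x => IsScalarTower.algebraMap_apply Ah (Ah ⧸ P) K₁ x
  -- the kernel of `Â → K̂₁` is `P`
  have hker : RingHom.ker (algebraMap Ah K₁) = P := by
    ext x
    rw [RingHom.mem_ker, halgmap, map_eq_zero_iff _ hRK₁, Ideal.Quotient.eq_zero_iff_mem]
  have hP₁ : RingHom.ker (algebraMap Ah K₁) ∈ minimalPrimes Ah := by
    rw [hker]
    exact hPmin
  -- `K̂₁` consists of fractions of elements of `Â`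
  have hK₁ : ∀ z : K₁, ∃ a b : Ah, z = algebraMap _ K₁ a / algebraMap _ K₁ b := by
    intro z
    obtain ⟨a, b, -, rfl⟩ := IsFractionRing.div_surjective (A := Ah ⧸ P) z
    obtain ⟨a', rfl⟩ := Ideal.Quotient.mk_surjective a
    obtain ⟨b', rfl⟩ := Ideal.Quotient.mk_surjective b
    exact ⟨a', b', by rw [halgmap, halgmap]⟩
  -- the embedding `ι : K → K̂₁` extending `A → Â → Â/P → K̂₁` (injective as `P ∩ A = 0`)
  have hinjA : Function.Injective ((algebraMap Ah K₁).comp (algebraMap A Ah)) := by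
    rw [injective_iff_map_eq_zero]
    intro x hx
    rw [RingHom.comp_apply] at hx
    have h1 : algebraMap A Ah x ∈ RingHom.ker (algebraMap Ah K₁) := RingHom.mem_ker.mpr hx
    rw [hker] at h1
    have h2 : x ∈ P.comap (algebraMap A Ah) := Ideal.mem_comap.mpr h1
    rwa [hPA, Ideal.mem_bot] at h2
  obtain ⟨ι, hι⟩ : ∃ ι : K →+* K₁,
      ι.comp (algebraMap A K) = (algebraMap Ah K₁).comp (algebraMap A Ah) :=
    ⟨IsFractionRing.lift hinjA, RingHom.ext fun x => by
      rw [RingHom.comp_apply, RingHom.comp_apply]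
      exact IsFractionRing.lift_algebraMap hinjA x⟩
  have hιH : ι.comp (algebraMap A K) =
      (algebraMap (Ah ⧸ P) K₁).comp ((Ideal.Quotient.mk P).comp (algebraMap A Ah)) := by
    rw [hι]
    refine RingHom.ext fun x => ?_
    rw [RingHom.comp_apply, RingHom.comp_apply, RingHom.comp_apply]
    exact halgmap _
  -- Step A's valuation ring `O'` of `K̂₁`
  obtain ⟨O', hRO', hdomR, halgR, hcomap⟩ := H (Ah ⧸ P) (Ideal.Quotient.mk P)
    Ideal.Quotient.mk_surjective Ideal.mk_ker K₁ hRK₁ ι hιH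
  -- its properties in terms of `Â` (`𝔪_A Â ⊆ 𝔪_Â` maps into `𝔪_{Â/P}`)
  have hmR : ∀ x ∈ (maximalIdeal A).map (algebraMap A Ah),
      Ideal.Quotient.mk P x ∈ maximalIdeal (Ah ⧸ P) := fun x hx => by
    rw [← AdicCompletion.maximalIdeal_eq_map] at hx
    exact (IsLocalRing.mem_maximalIdeal _).mpr fun hu =>
      ((IsLocalRing.mem_maximalIdeal x).mp hx) ((isUnit_map_iff (Ideal.Quotient.mk P) x).mp hu)
  have hRO'' : ∀ x : Ah, algebraMap Ah K₁ x ∈ O' := fun x => by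
    rw [halgmap]
    exact hRO' _
  have hdom'' : ∀ x ∈ (maximalIdeal A).map (algebraMap A Ah),
      O'.valuation (algebraMap Ah K₁ x) < 1 := fun x hx => by
    rw [halgmap]
    exact hdomR _ (hmR x hx)
  have hcompR : (algebraMap (Ah ⧸ P) K₁).comp (Ideal.Quotient.mk P) = algebraMap Ah K₁ :=
    RingHom.ext fun x => (halgmap x).symm
  have halg'' : ∀ y : O', ∃ p : Polynomial Ah,
      (∃ i, p.coeff i ∉ (maximalIdeal A).map (algebraMap A Ah)) ∧
      O'.valuation (p.eval₂ (algebraMap Ah K₁) y) < 1 := by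
    intro y
    obtain ⟨p, ⟨i, hi⟩, hlt⟩ := halgR y
    obtain ⟨q, rfl⟩ :=
      Polynomial.map_surjective (Ideal.Quotient.mk P) Ideal.Quotient.mk_surjective p
    refine ⟨q, ⟨i, fun hqi => hi ?_⟩, ?_⟩
    · rw [Polynomial.coeff_map]
      exact hmR _ hqi
    · rwa [Polynomial.eval₂_map, hcompR] at hlt
  -- the head, then repackage in `∃`-form
  obtain ⟨S', i1, i2, i3, i4, hloc, hess, htower, hSK₁, hSO', hdomS, d, z, a, c, g, hz, ha, hg⟩ :=
    headAt K₁ hP₁ hK₁ ι hι O' hRO'' hdom'' halg'' hcomap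
  exact ⟨K₁, inferInstance, inferInstance, hP₁, hK₁, ι, hι, O', halg'', hcomap, S', i1, i2, i3, i4,
    hloc, hess, htower, hSK₁, hSO', hdomS, d, z, a, c, g, hz, ha, hg⟩

end HeadForms


/-- **The named head implies the rank-one `∃`-form head** (for every field, every `B_𝔭`, every
rank-one `O`): `CossartPiltant2019_descentHead` (the `∀`-form over all branches and extensions,
all ranks) gives, at any valuation ring as in (LU), the `∃`-form output — so the leaf binders of
`CossartPiltant2019LU3OfComplete.of_headChoiceRankOne` and of the `CleanModels` leaf theorems
`…_headChoiceRankOne` are WEAKER than the named fact they replace.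
[cite: CossartPiltant2019, proof of Prop. 4.8 (arXiv v1: Prop. 4.6, pp. 52–53)] -/
theorem descentHeadChoiceRankOne_of_descentHead (hhead : CossartPiltant2019_descentHead.{u}) :
    CossartPiltant2019LUComplete3.{u} →
      ∀ (k B : Type u) [Field k] [CommRing B] [IsDomain B] [Algebra k B] [Algebra.FiniteType k B]
        (p : Ideal B) [p.IsMaximal], ringKrullDim B = 3 →
        ringKrullDim (Localization.AtPrime p) = 3 →
      ∀ (K : Type u) [Field K] [Algebra (Localization.AtPrime p) K]
        [IsFractionRing (Localization.AtPrime p) K] (O : ValuationSubring K),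
      Nonempty O.valuation.RankOne →
      (∀ x : Localization.AtPrime p, algebraMap _ K x ∈ O) →
      (∀ x ∈ maximalIdeal (Localization.AtPrime p), O.valuation (algebraMap _ K x) < 1) →
      (∀ y : O, ∃ q : Polynomial (Localization.AtPrime p),
        (∃ i, q.coeff i ∉ maximalIdeal (Localization.AtPrime p)) ∧
        O.valuation (q.eval₂ (algebraMap _ K) y) < 1) →
      ∃ (K₁ : Type u) (_ : Field K₁)
        (_ : Algebra (AdicCompletion (maximalIdeal (Localization.AtPrime p))
          (Localization.AtPrime p)) K₁),
        RingHom.ker (algebraMap (AdicCompletion (maximalIdeal (Localization.AtPrime p))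
          (Localization.AtPrime p)) K₁) ∈
          minimalPrimes (AdicCompletion (maximalIdeal (Localization.AtPrime p))
            (Localization.AtPrime p)) ∧
        (∀ z : K₁, ∃ a b : AdicCompletion (maximalIdeal (Localization.AtPrime p))
          (Localization.AtPrime p), z = algebraMap _ K₁ a / algebraMap _ K₁ b) ∧
        ∃ (ι : K →+* K₁), ι.comp (algebraMap (Localization.AtPrime p) K) =
          (algebraMap (AdicCompletion (maximalIdeal (Localization.AtPrime p))
            (Localization.AtPrime p)) K₁).comp (algebraMap (Localization.AtPrime p) _) ∧
        ∃ (O' : ValuationSubring K₁),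
          (∀ y : O', ∃ q : Polynomial (AdicCompletion (maximalIdeal (Localization.AtPrime p))
            (Localization.AtPrime p)),
            (∃ i, q.coeff i ∉ (maximalIdeal (Localization.AtPrime p)).map
              (algebraMap (Localization.AtPrime p)
                (AdicCompletion (maximalIdeal (Localization.AtPrime p))
                  (Localization.AtPrime p)))) ∧
            O'.valuation (q.eval₂ (algebraMap _ K₁) y) < 1) ∧
          O'.comap ι = O ∧
          ∃ (S : Type u) (_ : CommRing S) (_ : IsRegularLocalRing S)
            (_ : Algebra (AdicCompletion (maximalIdeal (Localization.AtPrime p))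
              (Localization.AtPrime p)) S) (_ : Algebra S K₁),
            IsLocalHom (algebraMap (AdicCompletion (maximalIdeal (Localization.AtPrime p))
              (Localization.AtPrime p)) S) ∧
            Algebra.EssFiniteType (AdicCompletion (maximalIdeal (Localization.AtPrime p))
              (Localization.AtPrime p)) S ∧
            IsScalarTower (AdicCompletion (maximalIdeal (Localization.AtPrime p))
              (Localization.AtPrime p)) S K₁ ∧
            Function.Injective (algebraMap S K₁) ∧
            (∀ s : S, algebraMap S K₁ s ∈ O') ∧
            (∀ s ∈ maximalIdeal S, O'.valuation (algebraMap S K₁ s) < 1) ∧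
            ∃ (d : ℕ) (z : Fin d → S) (a : Fin d → ℕ) (c : Fin d → Sˣ) (g : Fin d → K),
              Ideal.span (Set.range z) = maximalIdeal S ∧ (∀ j, 0 < a j) ∧
              ∀ j, ι (g j) = algebraMap S K₁ (c j * z j ^ a j) := by
  intro hc k B _ _ _ _ _ p _ h1 h2 K _ _ _ O _ hAO hdom halg
  haveI : IsNoetherianRing B := Algebra.FiniteType.isNoetherianRing k B
  haveI : IsNoetherianRing (Localization.AtPrime p) :=
    IsLocalization.isNoetherianRing p.primeCompl _ inferInstance
  exact headChoiceAt_of_headAt O hAO hdom halg (hhead hc k B p h1 h2 K O hAO hdom halg)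

end Literature.AlgebraicGeometry.Resolution

end
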